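import Summits.QuantumFields.YangMills.Theses.HyperbolicRegulator
import Literature.MathematicalPhysics.QuantumLattice.GaugeGroupsProofs
import Literature.MathematicalPhysics.QuantumFieldTheory.YangMillsOS

/-!
# `CurvatureAnchorR` (stmt-QuantumFields-18155) — Negative: the curvature floor `8 ≤ k` is load-bearing

Refuter (cdisprove `refuter-cdisprove-stmt-QuantumFields-18155-0`, 2026-08-17) negative lemma for the crux
`Summit.QuantumFields.YangMills.Theses.HyperbolicRegulator.CurvatureAnchorR` (route file rev 5).

`curvatureAnchorR_false_without_floor` : the crux with the guard `8 ≤ k →` deleted from its admissibility conjunct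
`(∀ k j, 8 ≤ k → (Φ k j).1)` — everything else byte-identical — is FALSE.  At curvature scale `k = 0` the Poincaré
clause `∑ f = 0 → ∑ f² ≤ 10⁶·k²·∑_E (f σe − f τe)²` has constant `0`, so every mean-zero `f` on `V` vanishes, i.e.
`|V| ≤ 1`; but clause 8 gives a (deep) vertex `x ∈ V`, clause 4 gives it degree `4` or `5`, hence an edge `e` at `x`, and
clause 1 makes `σ e ≠ τ e` two distinct vertices of `V` — test `f := 𝟙_{σ e} − 𝟙_{τ e}`.  The group is instantiated at the
tree-certified compact simple Lie group `SU(2)` (`isCompactSimpleLieGroup_specialUnitaryGroup`), whose `LatticeRep` is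
inhabited, so the statement is refuted outright (no hypothesis left pending).

Reading for provers/planners: any proof of the crux uses the floor only through admissibility at small `k`; the clustering
conjunct is untouched by this lemma. [folklore]
-/

set_option autoImplicit false

namespace Summit.QuantumFields.YangMills.Theorems.CurvatureAnchorR.Negative

open Literature.MathematicalPhysics.QuantumFieldTheory Literature.MathematicalPhysics.QuantumLattice MeasureTheory

/-- **`CurvatureAnchorR` without the floor `8 ≤ k` is false** (the route decl verbatim with the single token
`8 ≤ k →` removed from the admissibility conjunct; witness `k = 0`, `G = SU(2)`). [folklore] -/
theorem curvatureAnchorR_false_without_floor : ¬ (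
    open Literature.MathematicalPhysics.QuantumFieldTheory Literature.MathematicalPhysics.QuantumLattice MeasureTheory in ∀ (G : Type) [Group G] [TopologicalSpace G] [IsTopologicalGroup G] [CompactSpace G], IsCompactSimpleLieGroup G → letI : MeasurableSpace G := borel G; haveI : BorelSpace G := ⟨rfl⟩; ∀ r : LatticeRep G, let Fam := fun (k j : ℕ) (V E Q : Finset ℕ) (σ τ : ℕ → ℕ) (bd : ℕ → Fin 4 → ℕ × Bool) (cV : ℕ → ℤ × ℤ → ℕ) (cE : ℕ → ℤ × ℤ → Fin 2 → ℕ × Bool) => let st := fun e : ℕ × Bool => if e.2 then σ e.1 else τ e.1; let en := fun e : ℕ × Bool => if e.2 then τ e.1 else σ e.1; let Γ := SimpleGraph.fromRel fun a b : ℕ => ∃ e ∈ E, σ e = a ∧ τ e = b; let dg := fun x : ℕ => (E.filter fun e => σ e = x ∨ τ e = x).card; let K := V.filter fun x => dg x = 5; let F := fun x : ℕ => x ∈ V ∧ ∀ c ∈ K, k / 2 < Γ.dist x c; let Dp := fun x : ℕ => x ∈ V ∧ ∀ c ∈ K, 3 * (k / 4) < Γ.dist x c; let ib := fun a : ℤ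 × ℤ => |a.1| ≤ (k : ℤ) / 4 ∧ |a.2| ≤ (k : ℤ) / 4; let nx := fun (a : ℤ × ℤ) (μ : Fin 2) => if μ = 0 then (a.1 + 1, a.2) else (a.1, a.2 + 1); let Ed := (ℕ × ℕ) ⊕ (ℕ × ℕ); let PE : Finset Ed := (E ×ˢ V).disjSum (V ×ˢ E); let Cfg := ↥PE → G; let ν := Measure.pi fun _ : ↥PE => haarProbability G; let v := fun (U : Cfg) (e : Ed × Bool) => if h : e.1 ∈ PE then (if e.2 then U ⟨e.1, h⟩ else (U ⟨e.1, h⟩)⁻¹) else 1; let w := fun (U : Cfg) (e : Fin 4 → Ed × Bool) => (r.ρ (v U (e 0) * v U (e 1) * v U (e 2) * v U (e 3))).trace.re; let S := fun U : Cfg => (∑ q ∈ Q, ∑ y ∈ V, w U fun i => (Sum.inl ((bd q i).1, y), (bd q i).2)) + (∑ y ∈ V, ∑ q ∈ Q, w U fun i => (Sum.inr (y, (bd q i).1), (bd q i).2)) + ∑ e ∈ E, ∑ e' ∈ E, w U ![(Sum.inl (e, σ e'), true), (Sum.inr (τ e, e'), true), (Sum.inl (e, τ e'), false), (Sum.inr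 (σ e, e'), false)]; let d0 : Fin 4 → Fin 2 := ![0, 1, 0, 1]; let P := fun (x x' : ℕ) (U : Cfg) (p : ZdEdge 4) => let a := (p.1 0, p.1 1); let b := (p.1 2, p.1 3); if p.2 = 0 ∨ p.2 = 1 then v U (Sum.inl ((cE x a (d0 p.2)).1, cV x' b), (cE x a (d0 p.2)).2) else v U (Sum.inr (cV x a, (cE x' b (d0 p.2)).1), (cE x' b (d0 p.2)).2); ((∀ e ∈ E, σ e ∈ V ∧ τ e ∈ V ∧ σ e ≠ τ e) ∧ (∀ q ∈ Q, (∀ i, (bd q i).1 ∈ E) ∧ (∀ i, en (bd q i) = st (bd q (i + 1))) ∧ (st ∘ bd q).Injective) ∧ (∀ e ∈ E, (Q.filter fun q => ∃ i, (bd q i).1 = e).card = 2) ∧ (∀ x ∈ V, (dg x = 4 ∨ dg x = 5) ∧ (Q.filter fun q => ∃ i, st (bd q i) = x).card = dg x) ∧ (∀ x ∈ V, ∃ c ∈ K, Γ.dist x c ≤ k) ∧ (∀ c ∈ K, ∀ c' ∈ K, c ≠ c' → k ≤ Γ.dist c c') ∧ (∀ f : ℕ → ℝ, ∑ x ∈ V,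 f x = 0 → ∑ x ∈ V, f x ^ 2 ≤ 10 ^ 6 * (k : ℝ) ^ 2 * ∑ e ∈ E, (f (σ e) - f (τ e)) ^ 2) ∧ (∃ x y, Dp x ∧ Dp y ∧ j ≤ Γ.dist x y) ∧ (∀ x, F x → cV x (0, 0) = x ∧ (∀ a, ib a → cV x a ∈ V) ∧ Set.InjOn (cV x) {a | ib a} ∧ (∀ a μ, ib a → ib (nx a μ) → (cE x a μ).1 ∈ E ∧ st (cE x a μ) = cV x a ∧ en (cE x a μ) = cV x (nx a μ)) ∧ (∀ a, ib a → ib (a.1 + 1, a.2 + 1) → ∃ q ∈ Q, Finset.univ.image (Prod.fst ∘ bd q) = {(cE x a 0).1, (cE x (nx a 0) 1).1, (cE x (nx a 1) 0).1, (cE x a 1).1})), fun (β m C : ℝ) (A B : YMSpecies G) => let X := fun f : Cfg → ℝ => (∫ U, f U * Real.exp (β * S U) ∂ν) / (∫ U, Real.exp (β * S U) ∂ν); ∀ x x' y y', F x → F x' → F y → F y' → |X (fun U => A.F (P x x' U) * B.F (P y y' U)) - X (fun U => A.F (P x x' U)) * X (fun U => B.F (P y y' U))| ≤ C * Real.exp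 (-(m * ((Γ.dist x y + Γ.dist x' y' : ℕ) : ℝ)))); let Sp := fun (A : YMSpecies G) (R : ℕ) => ∀ p ∈ A.supp, ∀ i, |p.1 i| ≤ (R : ℤ); ∃ (V E Q : ℕ → ℕ → Finset ℕ) (σ τ : ℕ → ℕ → ℕ → ℕ) (bd : ℕ → ℕ → ℕ → Fin 4 → ℕ × Bool) (cV : ℕ → ℕ → ℕ → ℤ × ℤ → ℕ) (cE : ℕ → ℕ → ℕ → ℤ × ℤ → Fin 2 → ℕ × Bool), let Φ := fun k j => Fam k j (V k j) (E k j) (Q k j) (σ k j) (τ k j) (bd k j) (cV k j) (cE k j); (∀ k j, (Φ k j).1) ∧ (∃ c : ℝ, 0 < c ∧ ∀ k, 8 ≤ k → ∃ β₀ : ℝ, ∀ β, β₀ ≤ β → ∀ A B : YMSpecies G, Sp A (k / 8) → Sp B (k / 8) → ∃ C j₀, ∀ j, j₀ ≤ j → (Φ k j).2 β (c / k) C A B)) := by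
  intro h
  have hG : IsCompactSimpleLieGroup (Matrix.specialUnitaryGroup (Fin 2) ℂ) :=
    isCompactSimpleLieGroup_specialUnitaryGroup isSimpleCompactGroup_specialUnitaryGroup_holds le_rfl
  obtain ⟨r⟩ := hG.2
  obtain ⟨V, E, Q, σ, τ, bd, cV, cE, hAdm, -⟩ := h (Matrix.specialUnitaryGroup (Fin 2) ℂ) hG r
  obtain ⟨h1, -, -, h4, -, -, h7, ⟨x, -, ⟨hxV, -⟩, -, -⟩, -⟩ := hAdm 0 0
  obtain ⟨hdeg, -⟩ := h4 x hxV
  have hne : ((E 0 0).filter fun e => σ 0 0 e = x ∨ τ 0 0 e = x).Nonempty := by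
    rw [← Finset.card_pos]
    rcases hdeg with hd | hd <;> simp only [hd] <;> norm_num
  obtain ⟨e, he⟩ := hne
  obtain ⟨hu, hv, huv⟩ := h1 e (Finset.mem_filter.1 he).1
  have key := h7 (fun z => (if z = σ 0 0 e then (1 : ℝ) else 0) - (if z = τ 0 0 e then 1 else 0))
    (by rw [Finset.sum_sub_distrib, Finset.sum_ite_eq' , Finset.sum_ite_eq']; simp [hu, hv])
  have hone : (1 : ℝ) ≤ ∑ z ∈ V 0 0,
      ((if z = σ 0 0 e then (1 : ℝ) else 0) - (if z = τ 0 0 e then 1 else 0)) ^ 2 := by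
    have hterm : ((if σ 0 0 e = σ 0 0 e then (1 : ℝ) else 0) - (if σ 0 0 e = τ 0 0 e then 1 else 0)) ^ 2 = 1 := by
      simp [huv]
    calc (1 : ℝ) = ((if σ 0 0 e = σ 0 0 e then (1 : ℝ) else 0) - (if σ 0 0 e = τ 0 0 e then 1 else 0)) ^ 2 :=
          hterm.symm
      _ ≤ _ := Finset.single_le_sum (f := fun z => ((if z = σ 0 0 e then (1 : ℝ) else 0) -
          (if z = τ 0 0 e then 1 else 0)) ^ 2) (fun _ _ => sq_nonneg _) hu
  have hzero : (10 : ℝ) ^ 6 * ((0 : ℕ) : ℝ) ^ 2 *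
      ∑ e' ∈ E 0 0, (((if σ 0 0 e' = σ 0 0 e then (1 : ℝ) else 0) - (if σ 0 0 e' = τ 0 0 e then 1 else 0)) -
        ((if τ 0 0 e' = σ 0 0 e then (1 : ℝ) else 0) - (if τ 0 0 e' = τ 0 0 e then 1 else 0))) ^ 2 = 0 := by
    simp
  linarith

end Summit.QuantumFields.YangMills.Theorems.CurvatureAnchorR.Negative
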